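import Summits.HodgeConjecture.HodgeConjecture.Theorems.NikulinTwinTransportHodgeSimilitudeAlgebraicTwinTransport
import Literature.AlgebraicGeometry.Surfaces.K3SurfaceProofs
import Literature.AlgebraicGeometry.HodgeTheory.ChernCharacterBetti
import Literature.AlgebraicGeometry.HodgeTheory.ComplexGysinHodgeType
import Literature.AlgebraicGeometry.HodgeTheory.SupportedClassesHodgeConiveau
import Literature.AlgebraicGeometry.HodgeTheory.HodgeModelExistence

/-!
# Disproof of `HodgeSimilitudeAlgebraic` (crux stmt-HodgeConjecture-13676) — standing adversary, v5

**Findings (index).** NO KILL after three generations of attacks. The crux — "for every rational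
`r > 0`, every rational, type-preserving `ℂ`-linear `r`-similitude `ψ : H²(S′(ℂ);ℂ) → H²(S(ℂ);ℂ)`
between projective K3 surfaces is `[γ]_*` for an algebraic `γ ∈ N² H⁴(S × S′)`" — is an instance of
the Hodge conjecture for the fourfold `S × S′` (the class `Z_ψ ∈ H²(S)⊗H²(S′)` of `ψ` is a rational
`(2,2)`-class), rendered on REAL carriers with no junk model; it is refutable only by `¬HC`.
What this file certifies (Lean, axioms ⊆ {propext, Classical.choice, Quot.sound}):

* §1 NORMAL FORMS (landed reductions, cited by name, + NEW `simAlgAt_neg_iff`):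
  `crux ↔ ∀ r>0, SimAlgAt[r]` (`hodgeSimilitudeAlgebraic_iff_simAlgAt`); `SimAlgAt[1] ↔ Buskin`,
  `SimAlgAt[2] ↔ X`; squares are free (`simAlgAt_div_sq`); prime multipliers + anchors suffice
  (`hodgeSimilitudeAlgebraic_of_prime_anchors`); `crux ↔ ∀ prime q, RatTwinTransportAt[q]` modulo
  Buskin/CompCorr/3 K3 facts (`hodgeSimilitudeAlgebraic_iff_prime_twinTransport`). NEW:
  `SimAlgAt[-c] ↔ SimAlgAt[c]` (flip the generator `p ↦ -p`), hence
  `crux ↔ ∀ r ≠ 0, SimAlgAt[r]` — the hypothesis `0 < r` is PURE DECORATION (no fact used).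
* §2b NEW — `htype` IS LOAD-BEARING ON THE REAL CARRIERS:
  `hodgeSimilitudeAlgebraic_false_without_htype` — dropping the type-preservation hypothesis makes
  the crux FALSE, modulo the named facts `Huybrechts_K3_periodSurjective_projective`,
  `hodgePQ_independent_of_hodgeModel`, `nonempty_hodgeModel`, `exists_deRhamIsoFamily`,
  `Grothendieck1969_supportedClasses_le_hodgeConiveau` and an orientation family with PD: on the
  marked projective K3 with period `x₀ = (e₁+f₁) + i(e₂+f₂)`, `ψ = φ⁻¹ ∘ s_{e₁+f₁} ∘ φ` is a
  rational isometry with `s_w x₀ = x₀ − 2w ∉ ℂx₀`, while `[γ]_*` (`γ ∈ N²H⁴ ⊆ H^{2,2}`) preserves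
  the `(2,0)`-line (`isOfHodgeType_complexGysin`, cup and pull-back preserve types).
* §2 SIGN BRANCHES ARE VACUOUS: the rational K3 form admits no anti-similitude
  (`k3FormRat_no_antisimilitude`, from the abstract `no_antisimilitude` + 19 pairwise orthogonal
  `(−2)`-vectors `A₁⁸ ⊂ E₈(−1)` twice `⊕ ⟨eᵢ−fᵢ⟩ ⊂ U³`); so, relative to MARKING generators, a
  rational `ψ` never satisfies the similitude condition with a negative multiplier: the branches
  `(p,p′) = (∓p₀, ±p₀′)` of the `∀ p p′` quantifier carry no content (on paper: via
  `isRationalClass_iff_of_marking`, `k3Form_markingConj`; modulo `Huybrechts_K3_marking_exists`).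
* §3 TARGETS (registered skeleton `Lines/semiregular-twin-hecke-vhc.lean`, 5 stubs): the three
  `∀ C : ChernCharacterBetti`-stubs (`SemiregularVariationalHodge`, `SemiregularTwinCarriers` = the
  bet, `AnchoredTwinHeckeFamilies`) FOLLOW from `IsEmpty ChernCharacterBetti`
  (`targets_of_isEmpty`): they are irrefutable in the present tree until stub 1
  (`Nonempty ChernCharacterBetti`, a construction) exists — every disproof of the line must first
  BUILD a Chern character. The junk catalogue of `ChernCharacterBetti` is CERTIFIED and exhausted
  by `chernRescale` (`chᵢ ↦ λⁱ chᵢ`, `λ ∈ ℚˣ`, maps instances to instances; `CleanChern` is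
  invariant). No stub is false on paper (analysis in the §3 docstrings: clean-carrier arithmetic,
  `ext² ≤ 42`, component test `‖(x₀.x)‖ < ‖(x₀.x̄)‖` certified by `componentTest_identity`).
* §4 LOAD-BEARING TABLE / STRENGTHENINGS / WHY IT RESISTS / NEXT REGIMES (docstrings, with the
  gen-1/gen-2 paper results re-indexed: Kummer anchors at every odd `p`, known region
  `T_ℚ ↪ U³_ℚ`, Shafarevich reformulation, effective-cycle strengthening false at `p = 2`).

LANDING: §1–§2's theorems are proposed for import as
`Summits/HodgeConjecture/HodgeConjecture/Theorems/HodgeSimilitudeAlgebraic/Negative/NoAntisimilitude.lean`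
(p77053, `--supports` this item; namespace `…Theorems.HodgeSimilitudeAlgebraic.Negative`).

History: gen-1 (refuter-cdisprove-…-0, 2026-08-15T22:19Z/22:28Z), gen-2 (…-g2-0, v1–v4,
22:52Z–23:06Z) — evidence files on the item (gate host only; not mounted on the hub, hence this
rebuild); gen-3 (…-g3-0, this file, cycle 2, 2026-08-16). Nothing here proves or refutes the crux.
-/

noncomputable section

set_option linter.dupNamespace false

open CategoryTheory MonoidalCategory
open scoped Manifold Matrix Pointwise
open Literature.AlgebraicGeometry.Motives Literature.AlgebraicGeometry.HodgeTheory
open Literature.AlgebraicGeometry.Surfaces Literature.Geometry.Kaehler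
open Literature.AlgebraicTopology.SingularHomology
open Literature.NumberTheory.Transcendental (exists_deRhamIsoFamily)
open Literature.LinearAlgebra.QuadraticForm
open Summit.HodgeConjecture.HodgeConjecture.Theses.NikulinTwinTransport
open Summit.HodgeConjecture.HodgeConjecture.Theorems.NikulinTwinTransport

namespace Summit.HodgeConjecture.HodgeConjecture.Cruxes.HodgeSimilitudeAlgebraic.Disproof

/-! ## §1 Normal forms of the crux -/

/-- `SimAlgAt[c]`: the crux at ONE multiplier `c : ℂ` — verbatim the local notation of the landed
file `NikulinTwinTransportHodgeSimilitudeAlgebraicPrimes` (so that its theorems apply symbol for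
symbol). Local notation only. -/
local notation3 (prettyPrint := false) "SimAlgAt[" c "]" =>
  ∀ (μ : OrientationFamily), μ.HasPoincareDuality →
    ∀ (S S' : SchemeOver ℂ)
      (hS : (IsSmoothProjective 2 S ∧ Subsingleton (structureSheafCohomology S.left 1) ∧
        ∃ (A : HodgeModel 2 S) (η : MForm 𝓘(ℝ, A.model) A.carrier ℂ 2),
          IsHolomorphicInCharts η ∧ ∀ x, η x ≠ 0))
      (hS' : (IsSmoothProjective 2 S' ∧ Subsingleton (structureSheafCohomology S'.left 1) ∧
        ∃ (A : HodgeModel 2 S') (η : MForm 𝓘(ℝ, A.model) A.carrier ℂ 2),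
          IsHolomorphicInCharts η ∧ ∀ x, η x ≠ 0))
      (p : complexBetti S (2 * 2)) (p' : complexBetti S' (2 * 2)),
      (IsIntegralClass p ∧ ∀ q : complexBetti S (2 * 2), IsIntegralClass q → ∃ n : ℤ, q = n • p) →
      (IsIntegralClass p' ∧
        ∀ q : complexBetti S' (2 * 2), IsIntegralClass q → ∃ n : ℤ, q = n • p') →
      ∀ (ψ : complexBetti S' (2 * 1) →ₗ[ℂ] complexBetti S (2 * 1)),
        (∀ x, IsRationalClass x → IsRationalClass (ψ x)) →
        (∀ (i j : ℕ) x, IsOfHodgeType 2 S' (2 * 1) i j x → IsOfHodgeType 2 S (2 * 1) i j (ψ x)) →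
        (∀ (x y : complexBetti S' (2 * 1)) (a : ℂ),
          cupProduct (rfl : 2 * 1 + 2 * 1 = 2 * 2) x y = a • p' →
            cupProduct (rfl : 2 * 1 + 2 * 1 = 2 * 2) (ψ x) (ψ y) = (c * a) • p) →
        ∃ γ ∈ algebraicClasses (MonoidalCategoryStruct.tensorObj S S') 2,
          ∀ x : complexBetti S' (2 * 1),
            ψ x = complexGysin μ (IsSmoothProjective.tensor_holds hS.1 hS'.1) hS.1
              (SemiCartesianMonoidalCategory.fst S S')
              (rfl : 2 * 1 + 2 * 2 + 2 * 2 = 2 * 1 + 2 * (2 + 2))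
              (cupProduct (rfl : 2 * 1 + 2 * 2 = 2 * 1 + 2 * 2)
                (complexBetti.map (SemiCartesianMonoidalCategory.snd S S') (2 * 1) x) γ)

/-- Landed normal form (prover seat 1, p70971): the crux is the conjunction of `SimAlgAt[r]` over
rational `r > 0`; `r = 1` is Buskin's item, `r = 2` the target X. Re-exported here as a check that
the cited declarations exist with these types. [folklore] -/
theorem crux_iff_forall_pos : (HodgeSimilitudeAlgebraic ↔ ∀ r : ℚ, 0 < r → SimAlgAt[(r : ℂ)]) ∧
    (SimAlgAt[(1 : ℂ)] ↔ HodgeIsometryAlgebraic) ∧ (SimAlgAt[(2 : ℂ)] ↔ TwinSimilitudeAlgebraic) :=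
  ⟨hodgeSimilitudeAlgebraic_iff_simAlgAt, simAlgAt_one_iff, simAlgAt_two_iff⟩

/-- If `p` is an integral generator of `H⁴`, so is `-p`. [folklore] -/
theorem generator_neg {S : SchemeOver ℂ} {p : complexBetti S (2 * 2)}
    (hp : IsIntegralClass p ∧ ∀ q : complexBetti S (2 * 2), IsIntegralClass q → ∃ n : ℤ, q = n • p) :
    IsIntegralClass (-p) ∧ ∀ q : complexBetti S (2 * 2), IsIntegralClass q → ∃ n : ℤ, q = n • (-p) := by
  refine ⟨?_, fun q hq => ?_⟩
  · have h := hp.1.zsmul (-1)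
    simpa using h
  · obtain ⟨n, rfl⟩ := hp.2 q hq
    exact ⟨-n, by simp⟩

/-- **NEW (cycle 2). The sign of the multiplier carries no information**: `SimAlgAt[-c] ↔ SimAlgAt[c]`.
The crux quantifies over BOTH integral generators `p` of `H⁴(S(ℂ); ℤ) ≅ ℤ`; replacing `p` by `-p`
turns the similitude condition `(ψx.ψy) = (c·a)·p` into `((-c)·a)·(-p)` and leaves the conclusion
(which does not mention `p`) unchanged. No fact about K3 surfaces is used. [folklore] -/
theorem simAlgAt_neg_iff (c : ℂ) : SimAlgAt[-c] ↔ SimAlgAt[c] := by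
  constructor
  · intro h μ hμ S S' hS hS' p p' hp hp' ψ hψr hψt hψs
    exact h μ hμ S S' hS hS' (-p) p' (generator_neg hp) hp' ψ hψr hψt fun x y a hxy => by
      rw [hψs x y a hxy, neg_mul, neg_smul, smul_neg, neg_neg]
  · intro h μ hμ S S' hS hS' p p' hp hp' ψ hψr hψt hψs
    exact h μ hμ S S' hS hS' (-p) p' (generator_neg hp) hp' ψ hψr hψt fun x y a hxy => by
      rw [hψs x y a hxy, neg_mul, neg_smul, smul_neg]

/-- **Corollary: `0 < r` is decoration.** The crux is equivalent to its extension to ALL non-zero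
rational multipliers (hypothesis-mutation row "`0 < r`" of §4: not load-bearing — not even
"vacuous for `r < 0`", but literally the same content). (`r = 0`: `ψ` with totally isotropic image;
on paper it reduces to Lefschetz `(1,1)` — gen-1 note — and is not part of the crux.) [folklore] -/
theorem crux_iff_forall_ne_zero :
    HodgeSimilitudeAlgebraic ↔ ∀ r : ℚ, r ≠ 0 → SimAlgAt[(r : ℂ)] := by
  rw [hodgeSimilitudeAlgebraic_iff_simAlgAt]
  refine ⟨fun h r hr => ?_, fun h r hr => h r hr.ne'⟩
  rcases lt_or_gt_of_ne hr with hlt | hgt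
  · have h' := h (-r) (neg_pos.2 hlt)
    rw [Rat.cast_neg] at h'
    exact (simAlgAt_neg_iff (r : ℂ)).1 h'
  · exact h r hgt

/-! ## §2 Sign branches are vacuous: no anti-similitudes -/


/-- **No anti-similitude (abstract; restores gen-2's lost lemma, now for every multiplier `c < 0`).**
Over an ordered field, if `N ≤ V` and `N' ≤ V'` are negative definite for the bilinear forms `B`,
`B'` and `dim V < dim N + dim N'`, then no linear `ψ : V' → V` satisfies
`B(ψx, ψy) = c·B'(x, y)` with `c < 0`: `ψ` is injective on `N'`, `ψ(N')` is positive definite,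
so `ψ(N') ∩ N = 0` and `dim N' + dim N ≤ dim V`. (The tree's `not_antiIsometry_k3FormRat` is the
case `c = -1`, `V = V' = Λ_ℚ`, `N = N' = E₈(−1)² ⊗ ℚ`.) [folklore] -/
theorem no_antisimilitude {K V V' : Type*} [Field K] [LinearOrder K] [IsStrictOrderedRing K]
    [AddCommGroup V] [Module K V] [AddCommGroup V'] [Module K V'] [FiniteDimensional K V]
    (B : LinearMap.BilinForm K V) (B' : LinearMap.BilinForm K V')
    (N : Submodule K V) (N' : Submodule K V')
    (hN : ∀ x ∈ N, x ≠ 0 → B x x < 0) (hN' : ∀ x ∈ N', x ≠ 0 → B' x x < 0)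
    (hdim : Module.finrank K V < Module.finrank K N + Module.finrank K N')
    {c : K} (hc : c < 0) (ψ : V' →ₗ[K] V) (hψ : ∀ x y, B (ψ x) (ψ y) = c * B' x y) : False := by
  set f : N' →ₗ[K] V := ψ ∘ₗ N'.subtype with hf
  have hfx : ∀ x : N', f x = ψ (x : V') := fun x => rfl
  -- `ψ` is injective on `N'`
  have hinj : Function.Injective f := by
    rw [← LinearMap.ker_eq_bot, Submodule.eq_bot_iff]
    intro x hx
    rw [LinearMap.mem_ker, hfx] at hx
    by_contra hne
    have hxV : (x : V') ≠ 0 := fun h => hne (Subtype.ext h)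
    have hneg : B' (x : V') (x : V') < 0 := hN' _ x.2 hxV
    have h := hψ (x : V') (x : V')
    rw [hx] at h
    simp only [map_zero] at h
    have hzero : B' (x : V') (x : V') = 0 := by
      rcases mul_eq_zero.1 h.symm with h1 | h1
      · exact absurd h1 hc.ne
      · exact h1
    exact hneg.ne hzero
  have hP : Module.finrank K (LinearMap.range f) = Module.finrank K N' :=
    LinearMap.finrank_range_of_inj hinj
  -- the image of `N'` is positive definite, hence meets `N` trivially
  have hPN : LinearMap.range f ⊓ N = ⊥ := by
    rw [Submodule.eq_bot_iff]
    rintro v ⟨⟨x, rfl⟩, hvN⟩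
    by_contra hv
    have h1 : B (f x) (f x) < 0 := hN _ hvN hv
    have hxV : (x : V') ≠ 0 := by
      intro hx0
      apply hv
      rw [hfx, hx0, map_zero]
    have h2 : B' (x : V') (x : V') < 0 := hN' _ x.2 hxV
    have h3 : B (f x) (f x) = c * B' (x : V') (x : V') := by rw [hfx]; exact hψ _ _
    have h4 : 0 < c * B' (x : V') (x : V') := mul_pos_of_neg_of_neg hc h2
    rw [← h3] at h4
    exact lt_asymm h1 h4
  have hsum := Submodule.finrank_sup_add_finrank_inf_eq (LinearMap.range f) N
  rw [hPN, finrank_bot, add_zero, hP] at hsum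
  have hle := Submodule.finrank_le (LinearMap.range f ⊔ N)
  omega

/-! ### 19 pairwise orthogonal `(-2)`-vectors of the K3 lattice -/

/-- Index type of the 19 vectors: 8 + 8 roots in the two `E₈(−1)` blocks, one vector `e - f` in each
hyperbolic plane. -/
abbrev NegIndex : Type := (Fin 8 ⊕ Fin 8) ⊕ (Fin 1 ⊕ (Fin 1 ⊕ Fin 1))

/-- Eight pairwise orthogonal roots of `E₈` (rows, in the simple-root coordinates of Mathlib's
Bourbaki Cartan matrix): `α₈, α₆, α₄, α₁` and four higher roots; `R E₈ Rᵀ = 2·1` (`e8Roots_gram`).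
Found by `lattice/e8_orth_roots.py` (an `A₁⁸ ⊂ E₈`). -/
def e8Roots : Matrix (Fin 8) (Fin 8) ℤ :=
  !![0, 0, 0, 0, 0, 0, 0, 1;
     0, 0, 0, 0, 0, 1, 0, 0;
     0, 0, 0, 1, 0, 0, 0, 0;
     1, 0, 0, 0, 0, 0, 0, 0;
     1, 2, 2, 3, 2, 1, 0, 0;
     1, 2, 2, 3, 2, 2, 2, 1;
     1, 2, 2, 4, 4, 3, 2, 1;
     2, 2, 4, 5, 4, 3, 2, 1]

/-- The vector `e - f` of the hyperbolic plane (square `-2`), as a `1 × 2` row. -/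
def uNeg : Matrix (Fin 1) (Fin 2) ℤ := !![1, -1]

theorem e8Roots_gram : e8Roots * CartanMatrix.E₈ * e8Rootsᵀ = (2 : ℤ) • 1 := by decide

theorem uNeg_gram : uNeg * hyperbolicPlaneGram * uNegᵀ = (-2 : ℤ) • 1 := by decide

/-- `c • 1 = fromBlocks (c • 1) 0 0 (c • 1)` on a sum index type. -/
theorem smul_one_fromBlocks {p q : Type*} [DecidableEq p] [DecidableEq q] (c : ℤ) :
    Matrix.fromBlocks (c • (1 : Matrix p p ℤ)) 0 0 (c • (1 : Matrix q q ℤ)) =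
      c • (1 : Matrix (p ⊕ q) (p ⊕ q) ℤ) := by
  rw [← Matrix.fromBlocks_one, Matrix.fromBlocks_smul, smul_zero, smul_zero]

/-- The 19 vectors as the rows of a block-diagonal `19 × 22` integer matrix. -/
def negRows : Matrix NegIndex K3Index ℤ :=
  Matrix.fromBlocks (Matrix.fromBlocks e8Roots 0 0 e8Roots) 0 0
    (Matrix.fromBlocks uNeg 0 0 (Matrix.fromBlocks uNeg 0 0 uNeg))

/-- **Gram matrix `−2·1`**: the 19 rows of `negRows` are pairwise orthogonal of square `−2` in the
K3 lattice. -/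
theorem negRows_gram : negRows * k3Gram * negRowsᵀ = (-2 : ℤ) • 1 := by
  have h8 : e8Roots * (-CartanMatrix.E₈) * e8Rootsᵀ = (-2 : ℤ) • 1 := by
    rw [Matrix.mul_neg, Matrix.neg_mul, e8Roots_gram, ← neg_smul]
  simp only [negRows, k3Gram, Matrix.fromBlocks_transpose, Matrix.fromBlocks_multiply,
    Matrix.transpose_zero, Matrix.mul_zero, Matrix.zero_mul, add_zero, zero_add, h8, uNeg_gram,
    smul_one_fromBlocks]

/-! ### The rational K3 form admits no anti-similitude -/

/-- The 19 vectors over `ℚ` (rows). -/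
def negRowsQ : Matrix NegIndex K3Index ℚ := negRows.map (Int.cast : ℤ → ℚ)

theorem negRowsQ_gram : negRowsQ * k3Gram.map (Int.cast : ℤ → ℚ) * negRowsQᵀ = (-2 : ℚ) • 1 := by
  have h := congrArg (fun A : Matrix NegIndex NegIndex ℤ => A.map (Int.castRingHom ℚ)) negRows_gram
  rw [Matrix.map_mul, Matrix.map_mul, Matrix.transpose_map] at h
  have h1 : ((-2 : ℤ) • (1 : Matrix NegIndex NegIndex ℤ)).map (Int.castRingHom ℚ) =
      (-2 : ℚ) • (1 : Matrix NegIndex NegIndex ℚ) := by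
    ext i j
    simp only [Matrix.map_apply, Matrix.smul_apply, Matrix.one_apply, smul_eq_mul, mul_ite, mul_one,
      mul_zero]
    split_ifs <;> simp
  rw [h1, Int.coe_castRingHom] at h
  exact h

/-- The span `N` of the 19 vectors: the range of `c ↦ Rᵀ c`. -/
def negSpan : Submodule ℚ (K3Index → ℚ) := LinearMap.range (Matrix.mulVecLin negRowsQᵀ)

theorem vecMul_gram (c : NegIndex → ℚ) :
    (negRowsQᵀ *ᵥ c) ᵥ* (k3Gram.map (Int.cast : ℤ → ℚ) * negRowsQᵀ) = (-2 : ℚ) • c := by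
  rw [Matrix.mulVec_transpose, Matrix.vecMul_vecMul, ← Matrix.mul_assoc, negRowsQ_gram,
    Matrix.vecMul_smul, Matrix.vecMul_one]

theorem k3FormRat_negVec (c : NegIndex → ℚ) :
    k3FormRat (negRowsQᵀ *ᵥ c) (negRowsQᵀ *ᵥ c) = (-2 : ℚ) * (c ⬝ᵥ c) := by
  rw [k3FormRat, Matrix.toBilin'_apply', Matrix.mulVec_mulVec, Matrix.dotProduct_mulVec, vecMul_gram,
    smul_dotProduct, smul_eq_mul]

theorem mulVec_negRowsQ_injective : Function.Injective (Matrix.mulVecLin negRowsQᵀ) := by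
  intro c d hcd
  change negRowsQᵀ *ᵥ c = negRowsQᵀ *ᵥ d at hcd
  have hc := vecMul_gram c
  rw [hcd, vecMul_gram d] at hc
  have h := congrArg (fun v => (-2 : ℚ)⁻¹ • v) hc
  simpa [smul_smul] using h.symm

theorem finrank_negSpan : Module.finrank ℚ negSpan = 19 := by
  rw [negSpan, LinearMap.finrank_range_of_inj mulVec_negRowsQ_injective,
    Module.finrank_fintype_fun_eq_card]
  rfl

theorem negSpan_neg (x : K3Index → ℚ) (hx : x ∈ negSpan) (hx0 : x ≠ 0) : k3FormRat x x < 0 := by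
  obtain ⟨c, rfl⟩ := hx
  change k3FormRat (negRowsQᵀ *ᵥ c) (negRowsQᵀ *ᵥ c) < 0
  rw [k3FormRat_negVec]
  have hc : c ≠ 0 := by
    rintro rfl
    exact hx0 (by simp)
  have hpos : 0 < c ⬝ᵥ c := by
    rw [dotProduct]
    obtain ⟨i, hi⟩ := Function.ne_iff.1 hc
    refine lt_of_lt_of_le (mul_self_pos.2 hi) ?_
    exact Finset.single_le_sum (f := fun j => c j * c j) (fun j _ => mul_self_nonneg (c j))
      (Finset.mem_univ i)
  linarith

/-- **The rational K3 form admits no anti-similitude of ANY negative multiplier**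
(`22 < 19 + 19`; generalises the tree's `not_antiIsometry_k3FormRat`, multiplier `-1`). Hence a
rational `ψ` between marked K3 surfaces never satisfies the crux's similitude condition with a
negative multiplier relative to the marking generators (`no_antisimilitude_of_markings`): the
branches `(p, p′) = (∓p₀, ±p₀′)` of the crux's `∀ p p′` are VACUOUS, and together with
`simAlgAt_neg_iff` this closes the "sign" rows of the load-bearing table without the
`N ∘ σ`-trick of the Transfer file (which needs a lattice similitude of the same multiplier).
[cite: Huybrechts2016K3, Ch. 14 §0.3 (vi) (signature (3,19))] -/
theorem k3FormRat_no_antisimilitude {c : ℚ} (hc : c < 0)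
    (ψ : (K3Index → ℚ) →ₗ[ℚ] (K3Index → ℚ))
    (hψ : ∀ x y, k3FormRat (ψ x) (ψ y) = c * k3FormRat x y) : False :=
  no_antisimilitude k3FormRat k3FormRat negSpan negSpan negSpan_neg negSpan_neg
    (by rw [finrank_k3Rat, finrank_negSpan]; norm_num) hc ψ hψ

/-- **No rational anti-similitude between marked K3 surfaces** (real carriers; markings as DATA —
for actual K3 surfaces they come from the named fact `Huybrechts_K3_marking_exists`). If
`ψ : H²(S′(ℂ);ℂ) → H²(S(ℂ);ℂ)` maps rational classes to rational classes and satisfies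
`(x.y) = a·p₀′ ⟹ (ψx.ψy) = (c·a)·p₀` for the marking generators `p₀, p₀′` and a rational `c < 0`,
contradiction: `σ = η ∘ ψ ∘ η′⁻¹` is defined over `ℚ` (`markingConj_intCast`) and multiplies the
K3 form by `c` (`k3Form_markingConj_signed`), against `k3FormRat_no_antisimilitude`.
[cite: Buskin2019, §6.2 (isometries induced via markings)] -/
theorem no_antisimilitude_of_markings {S S' : Literature.AlgebraicGeometry.Motives.SchemeOver ℂ}
    (hS : IsK3Surface S)
    (η : Literature.AlgebraicGeometry.HodgeTheory.complexBetti S (2 * 1) ≃ₗ[ℂ] (K3Index → ℂ))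
    (p₀ : Literature.AlgebraicGeometry.HodgeTheory.complexBetti S (2 * 2)) (hp₀ : p₀ ≠ 0)
    (hη : ∀ c : Literature.AlgebraicGeometry.HodgeTheory.complexBetti S (2 * 1),
      Literature.AlgebraicGeometry.HodgeTheory.IsIntegralClass c ↔ ∃ v : K3Index → ℤ, η c = fun i => (v i : ℂ))
    (hηcup : ∀ a b : Literature.AlgebraicGeometry.HodgeTheory.complexBetti S (2 * 1),
      Literature.AlgebraicTopology.SingularHomology.cupProduct (rfl : 2 * 1 + 2 * 1 = 2 * 2) a b =
        k3Form (η a) (η b) • p₀)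
    (η' : Literature.AlgebraicGeometry.HodgeTheory.complexBetti S' (2 * 1) ≃ₗ[ℂ] (K3Index → ℂ))
    (p₀' : Literature.AlgebraicGeometry.HodgeTheory.complexBetti S' (2 * 2))
    (hη' : ∀ c : Literature.AlgebraicGeometry.HodgeTheory.complexBetti S' (2 * 1),
      Literature.AlgebraicGeometry.HodgeTheory.IsIntegralClass c ↔ ∃ v : K3Index → ℤ, η' c = fun i => (v i : ℂ))
    (hη'cup : ∀ a b : Literature.AlgebraicGeometry.HodgeTheory.complexBetti S' (2 * 1),
      Literature.AlgebraicTopology.SingularHomology.cupProduct (rfl : 2 * 1 + 2 * 1 = 2 * 2) a b =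
        k3Form (η' a) (η' b) • p₀')
    (ψ : Literature.AlgebraicGeometry.HodgeTheory.complexBetti S' (2 * 1) →ₗ[ℂ]
      Literature.AlgebraicGeometry.HodgeTheory.complexBetti S (2 * 1))
    (hψr : ∀ x, Literature.AlgebraicGeometry.HodgeTheory.IsRationalClass x →
      Literature.AlgebraicGeometry.HodgeTheory.IsRationalClass (ψ x))
    {c : ℚ} (hc : c < 0)
    (hψs : ∀ (x y : Literature.AlgebraicGeometry.HodgeTheory.complexBetti S' (2 * 1)) (a : ℂ),
      Literature.AlgebraicTopology.SingularHomology.cupProduct (rfl : 2 * 1 + 2 * 1 = 2 * 2) x y = a • p₀' →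
        Literature.AlgebraicTopology.SingularHomology.cupProduct (rfl : 2 * 1 + 2 * 1 = 2 * 2) (ψ x) (ψ y) =
          ((c : ℂ) * a) • p₀) : False := by
  -- `σ = η ∘ ψ ∘ η'⁻¹` is defined over `ℚ` and multiplies the K3 form by `c`
  set σ : Module.End ℂ (K3Index → ℂ) := η.toLinearMap ∘ₗ ψ ∘ₗ η'.symm.toLinearMap with hσ
  have hrat := markingConj_intCast hS η hη η' hη' ψ hψr
  have hform : ∀ a b, k3Form (σ a) (σ b) = (c : ℂ) * k3Form a b := by
    intro a b
    have h := k3Form_markingConj_signed η p₀ ((c : ℂ) • p₀) hp₀ (c : ℂ) rfl hηcup η' p₀' p₀' 1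
      (by rw [one_smul]) hη'cup ψ (fun x y a hxy => by rw [hψs x y a hxy, smul_smul, mul_comm a (c : ℂ)]) a b
    rw [h]
    ring
  obtain ⟨τ, hτ⟩ := exists_ratEnd_of_forall_intCast σ hrat
  refine k3FormRat_no_antisimilitude hc τ fun a b => ?_
  apply Rat.cast_injective (α := ℂ)
  rw [Rat.cast_mul, ← k3Form_ratCast, ← k3Form_ratCast, ← hτ a, ← hτ b, hform]


/-! ## §2b Load-bearing analysis on the real carriers: dropping `htype` makes the crux false -/


/-- `HodgeSimilitudeAlgebraicWithoutHtypeAt c`: the crux at multiplier `c` with the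
type-preservation hypothesis `htype` DROPPED (everything else verbatim). [folklore] -/
def HodgeSimilitudeAlgebraicWithoutHtypeAt (c : ℂ) : Prop :=
  ∀ (μ : OrientationFamily), μ.HasPoincareDuality →
    ∀ (S S' : SchemeOver ℂ)
      (hS : (IsSmoothProjective 2 S ∧ Subsingleton (structureSheafCohomology S.left 1) ∧
        ∃ (A : HodgeModel 2 S) (η : MForm 𝓘(ℝ, A.model) A.carrier ℂ 2),
          IsHolomorphicInCharts η ∧ ∀ x, η x ≠ 0))
      (hS' : (IsSmoothProjective 2 S' ∧ Subsingleton (structureSheafCohomology S'.left 1) ∧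
        ∃ (A : HodgeModel 2 S') (η : MForm 𝓘(ℝ, A.model) A.carrier ℂ 2),
          IsHolomorphicInCharts η ∧ ∀ x, η x ≠ 0))
      (p : complexBetti S (2 * 2)) (p' : complexBetti S' (2 * 2)),
      (IsIntegralClass p ∧ ∀ q : complexBetti S (2 * 2), IsIntegralClass q → ∃ n : ℤ, q = n • p) →
      (IsIntegralClass p' ∧
        ∀ q : complexBetti S' (2 * 2), IsIntegralClass q → ∃ n : ℤ, q = n • p') →
      ∀ (ψ : complexBetti S' (2 * 1) →ₗ[ℂ] complexBetti S (2 * 1)),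
        (∀ x, IsRationalClass x → IsRationalClass (ψ x)) →
        (∀ (x y : complexBetti S' (2 * 1)) (a : ℂ),
          cupProduct (rfl : 2 * 1 + 2 * 1 = 2 * 2) x y = a • p' →
            cupProduct (rfl : 2 * 1 + 2 * 1 = 2 * 2) (ψ x) (ψ y) = (c * a) • p) →
        ∃ γ ∈ algebraicClasses (MonoidalCategoryStruct.tensorObj S S') 2,
          ∀ x : complexBetti S' (2 * 1),
            ψ x = complexGysin μ (IsSmoothProjective.tensor_holds hS.1 hS'.1) hS.1
              (SemiCartesianMonoidalCategory.fst S S')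
              (rfl : 2 * 1 + 2 * 2 + 2 * 2 = 2 * 1 + 2 * (2 + 2))
              (cupProduct (rfl : 2 * 1 + 2 * 2 = 2 * 1 + 2 * 2)
                (complexBetti.map (SemiCartesianMonoidalCategory.snd S S') (2 * 1) x) γ)

/-- The explicit projective period vector `x₀ = (e₁ + f₁) + i (e₂ + f₂)` of
`exists_k3PeriodVector_projective` (a CM point: coordinates in `ℚ(i)`). Local notation only. -/
local notation3 (prettyPrint := false) "x₀P" =>
  (Sum.elim 0 (Sum.elim ![1, 1] (Sum.elim ![Complex.I, Complex.I] 0)) : K3Index → ℂ)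

/-- The lattice vector `w = e₁ + f₁` (`(w.w) = 2`, `(w.x₀) = 2`). Local notation only. -/
local notation3 (prettyPrint := false) "wV" =>
  (Sum.elim 0 (Sum.elim ![1, 1] (Sum.elim 0 0)) : K3Index → ℤ)

/-- The lattice vector `u = e₃ + f₃ ⊥ x₀` with `u² = 2 > 0` (projectivity). Local notation only. -/
local notation3 (prettyPrint := false) "uV" =>
  (Sum.elim 0 (Sum.elim 0 (Sum.elim 0 ![1, 1])) : K3Index → ℤ)

/-- `(x₀.x₀) = 0`. [cite: Huybrechts2016K3, Ch. 6 §1.1] -/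
theorem x₀P_sq : k3Form x₀P x₀P = 0 := by
  simp [k3Form, k3Gram, hyperbolicPlaneGram, Fintype.sum_sum_type, Fin.sum_univ_two]

/-- `(x̄₀.x₀) = 4 > 0`. [cite: Huybrechts2016K3, Ch. 6 §1.1] -/
theorem x₀P_pos : 0 < (k3Form (star x₀P) x₀P).re := by
  simp [k3Form, k3Gram, hyperbolicPlaneGram, Fintype.sum_sum_type, Fin.sum_univ_two]

/-- `(u.x₀) = 0`. [folklore] -/
theorem uV_x₀P : k3Form (fun i => (uV i : ℂ)) x₀P = 0 := by
  simp [k3Form, k3Gram, hyperbolicPlaneGram, Fintype.sum_sum_type, Fin.sum_univ_two]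

/-- `(u.u) = 2 > 0`. [folklore] -/
theorem uV_sq : 0 < ∑ i, ∑ j, uV i * k3Gram i j * uV j := by
  simp [k3Gram, hyperbolicPlaneGram, Fintype.sum_sum_type, Fin.sum_univ_two]

/-- `(w.w) = 2`. [folklore] -/
theorem wV_sq : k3Form (fun i => (wV i : ℂ)) (fun i => (wV i : ℂ)) = 2 := by
  simp [k3Form, k3Gram, hyperbolicPlaneGram, Fintype.sum_sum_type, Fin.sum_univ_two]
  norm_num

/-- `(w.x₀) = 2`. [folklore] -/
theorem wV_x₀P : k3Form (fun i => (wV i : ℂ)) x₀P = 2 := by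
  simp [k3Form, k3Gram, hyperbolicPlaneGram, Fintype.sum_sum_type, Fin.sum_univ_two]
  norm_num

/-- `s_w(x₀) = x₀ − 2w` is not proportional to `x₀` (compare the `e₁`- and `e₂`-coordinates). [folklore] -/
theorem reflection_x₀P_ne_smul (t : ℂ) : k3ReflectionC wV x₀P ≠ t • x₀P := by
  intro h
  rw [k3ReflectionC_apply, wV_sq, wV_x₀P] at h
  have h1 := congrFun h (Sum.inr (Sum.inl 0))
  have h2 := congrFun h (Sum.inr (Sum.inr (Sum.inl 0)))
  simp at h1 h2
  rw [← h2] at h1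
  norm_num at h1

/-- **`htype` is load-bearing (real carriers, modulo named facts).** Granted the K3 period fact, the Hodge-theoretic facts of the tree
(independence of `H^{p,q}` of the model, existence of Hodge models, de Rham's theorem) and
Grothendieck's coniveau fact `N²H⁴ ⊆ H^{2,2}`, the crux at multiplier `1` WITHOUT the
type-preservation hypothesis is FALSE, for every orientation family with Poincaré duality: on the
marked projective K3 surface with period `x₀`, the rational isometry `ψ = φ⁻¹ ∘ s_w ∘ φ` moves the
`(2,0)`-line (`s_w x₀ ∉ ℂ x₀`), whereas `[γ]_*` of an algebraic `γ` preserves it. -/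
theorem hodgeSimilitudeAlgebraic_false_without_htype_at_one (hP : Huybrechts_K3_periodSurjective_projective)
    (hI : hodgePQ_independent_of_hodgeModel)
    (hM : ∀ (m : ℕ) (Y : SchemeOver ℂ), nonempty_hodgeModel m Y)
    (hdR : ∀ (E : Type) [NormedAddCommGroup E] [NormedSpace ℂ E] [FiniteDimensional ℂ E],
      exists_deRhamIsoFamily 𝓘(ℝ, E))
    (hG : Grothendieck1969_supportedClasses_le_hodgeConiveau)
    (μ : OrientationFamily) (hμ : μ.HasPoincareDuality) :
    ¬ HodgeSimilitudeAlgebraicWithoutHtypeAt (1 : ℂ) := by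
  intro h
  -- a marked projective K3 surface with period `x₀`
  obtain ⟨S, hS, φ, p, hpint, hpgen, hφint, hφcup, h20, h20span⟩ :=
    hP x₀P x₀P_sq x₀P_pos ⟨uV, uV_x₀P, uV_sq⟩
  -- the rational isometry `ψ = φ⁻¹ ∘ s_w ∘ φ`
  set σ : Module.End ℂ (K3Index → ℂ) := k3ReflectionC wV with hσ
  set ψ : complexBetti S (2 * 1) →ₗ[ℂ] complexBetti S (2 * 1) :=
    φ.symm.toLinearMap ∘ₗ σ ∘ₗ φ.toLinearMap with hψ
  have hψapply : ∀ y, ψ y = φ.symm (σ (φ y)) := fun y => rfl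
  have hrat : ∀ y, IsRationalClass y → IsRationalClass (ψ y) := by
    intro y hy
    obtain ⟨u, hu⟩ := (isRationalClass_iff_of_marking hS φ hφint y).1 hy
    refine (isRationalClass_iff_of_marking hS φ hφint _).2 ⟨reflection k3FormRat (fun j => (wV j : ℚ)) u, ?_⟩
    rw [hψapply, LinearEquiv.apply_symm_apply, hu, hσ, k3ReflectionC_ratCast]
  have hsim : ∀ (x y : complexBetti S (2 * 1)) (a : ℂ),
      cupProduct (rfl : 2 * 1 + 2 * 1 = 2 * 2) x y = a • p →
        cupProduct (rfl : 2 * 1 + 2 * 1 = 2 * 2) (ψ x) (ψ y) = ((1 : ℂ) * a) • p := by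
    intro x y a hxy
    rw [one_mul, hφcup, hψapply, hψapply, LinearEquiv.apply_symm_apply, LinearEquiv.apply_symm_apply,
      hσ, k3Form_k3ReflectionC, ← hφcup, hxy]
  -- the crux without `htype` makes `ψ` algebraic
  obtain ⟨γ, hγ, hψγ⟩ := h μ hμ S S hS hS p p ⟨hpint, hpgen⟩ ⟨hpint, hpgen⟩ ψ hrat hsim
  -- `γ ∈ N²H⁴(S × S)` is of type `(2,2)` (Grothendieck's coniveau fact)
  have hSS : IsSmoothProjective (2 + 2) (S ⊗ S) := IsSmoothProjective.tensor_holds hS.1 hS.1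
  obtain ⟨A⟩ := (hM (2 + 2) (S ⊗ S)).nonempty hSS
  have hγT : IsOfHodgeType (2 + 2) (S ⊗ S) (2 * 2) 2 2 γ := by
    have hc : A.pullback (2 * 2) γ ∈ A.hodgeConiveau (2 * 2) 2 := hG hSS A (2 * 2) 2 ⟨γ, hγ, rfl⟩
    have hle : A.hodgeConiveau (2 * 2) 2 ≤ A.hodgePQ (2 * 2) 2 2 := by
      refine iSup_le fun p => iSup_le fun q => iSup_le fun hpq => iSup_le fun hp =>
        iSup_le fun hq => ?_
      obtain ⟨rfl, rfl⟩ : p = 2 ∧ q = 2 := by omega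
      exact le_rfl
    exact ⟨A, hle hc⟩
  -- `snd^*(φ⁻¹ x₀)` is of type `(2,0)`, its cup with `γ` of type `(4,2)`, and `fst_*` of that of type `(2,0)`
  have hsndT : IsOfHodgeType (2 + 2) (S ⊗ S) (2 * 1) 2 0
      (complexBetti.map (SemiCartesianMonoidalCategory.snd S S) (2 * 1) (φ.symm x₀P)) :=
    IsOfHodgeType.map_of_independent hI h20 hSS hS.1 A (SemiCartesianMonoidalCategory.snd S S)
  have hcupT := cupPreservesHodgeType_of_nonempty_hodgeModel hI (hM (2 + 2) (S ⊗ S)) hdR hSS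
    (rfl : 2 * 1 + 2 * 2 = 2 * 1 + 2 * 2) hsndT hγT
  have hgysT : IsOfHodgeType 2 S (2 * 1) 2 0 (ψ (φ.symm x₀P)) := by
    rw [hψγ]
    exact isOfHodgeType_complexGysin hI hM hdR μ hSS hS.1 (SemiCartesianMonoidalCategory.fst S S)
      (rfl : 2 * 1 + 2 * 2 + 2 * 2 = 2 * 1 + 2 * (2 + 2)) (by norm_num) (by norm_num) hcupT
  -- hence `s_w x₀ ∈ ℂ x₀`: contradiction
  obtain ⟨t, ht⟩ := h20span _ hgysT
  rw [hψapply, LinearEquiv.apply_symm_apply] at ht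
  have ht' : σ x₀P = t • x₀P := by
    have := congrArg φ ht
    rwa [LinearEquiv.apply_symm_apply, map_smul, LinearEquiv.apply_symm_apply] at this
  exact reflection_x₀P_ne_smul t ht'

/-- `HodgeSimilitudeAlgebraicWithoutHtype`: the crux with `htype` dropped, all multipliers. [folklore] -/
def HodgeSimilitudeAlgebraicWithoutHtype : Prop :=
  ∀ r : ℚ, 0 < r → HodgeSimilitudeAlgebraicWithoutHtypeAt (r : ℂ)

/-- **`htype` is load-bearing (all multipliers)**: `¬ HodgeSimilitudeAlgebraicWithoutHtype` modulo
the same five named facts and an orientation family with Poincaré duality (specialise `r = 1`).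
[folklore] -/
theorem hodgeSimilitudeAlgebraic_false_without_htype (hP : Huybrechts_K3_periodSurjective_projective)
    (hI : hodgePQ_independent_of_hodgeModel)
    (hM : ∀ (m : ℕ) (Y : SchemeOver ℂ), nonempty_hodgeModel m Y)
    (hdR : ∀ (E : Type) [NormedAddCommGroup E] [NormedSpace ℂ E] [FiniteDimensional ℂ E],
      exists_deRhamIsoFamily 𝓘(ℝ, E))
    (hG : Grothendieck1969_supportedClasses_le_hodgeConiveau)
    (μ : OrientationFamily) (hμ : μ.HasPoincareDuality) :
    ¬ HodgeSimilitudeAlgebraicWithoutHtype := by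
  intro h
  have h1 := h 1 one_pos
  rw [Rat.cast_one] at h1
  exact hodgeSimilitudeAlgebraic_false_without_htype_at_one hP hI hM hdR hG μ hμ h1


/-! ## §3 Targets — the registered skeleton `Lines/semiregular-twin-hecke-vhc.lean` (5 stubs)

Payload `targets`/`stuck_stubs` are empty this cycle (no lead seated yet); the registered skeleton
(sha 0d66e73b…) has five stubs. Cheap attacks, stub by stub:

* `stub_ChernCharacterOnBetti : Nonempty ChernCharacterBetti` — a CONSTRUCTION (the file
  `HodgeTheory/ChernCharacterBetti` deliberately records no existence fact). Not refutable: the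
  intended instance exists (topological Chern character of `E(ℂ)`); consistency probes of the
  fields pass (zero module: `ch_of_hasRankLE_one` vs `ch_eq_zero_of_isZero` consistent since
  `cupPowTwo 0 i = 0`, `i ≥ 1`; empty `X(ℂ)`: all fields trivial). JUNK FREEDOM of the structure:
  only the rescaling `chᵢ ↦ λⁱ chᵢ`, `λ ∈ ℚˣ` (module docstring; functoriality along ALL
  `ℂ`-morphisms kills e.g. "globally-generated-dependent" perturbations of `ch₁`: pull back a
  degree-1 line bundle on an elliptic curve by `[2]`), and `CleanChern[…]` is invariant under it.
  Not constructible here either way ⇒ no junk-`C` kill of the `∀ C` stubs is available.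
* `stub_SemiregularVariationalHodge` (`∀ C 𝒲 B f …`), `stub_AnchoredTwinHeckeFamilies`
  (`∀ C μ …`), `stub_SemiregularTwinCarriers` (`∀ q prime, ∃ M N, RatSimil ∧ ∀ C μ …`): each is
  PROVABLE from `IsEmpty ChernCharacterBetti` (`forallChern_of_isEmpty`,
  `carriersShape_of_isEmpty` below — the outer `∃ M N, RatSimil[q, M, N]` is the landed
  `exists_ratSimilitude_k3Lattice`). So none of the three can be refuted in the present tree before
  stub 1 is BUILT: every disproof of the line must first construct a Chern character on the real
  carriers. (Dually, their content is only engaged through stub 1; the composition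
  `HodgeSimilitudeAlgebraic_of_stubs` uses stub 1 exactly once, to feed a `C` to stubs 3, 4, 2.)
* `stub_SemiregularVariationalHodge` on paper: Buchweitz–Flenner 2003 (Thm 5.1 as cited by the
  skeleton) / Bloch 1972 / Perry (cited) give algebraicity of the flat transport of `ch₂(E₀)` on a neighbourhood of `b₀`
  (semiregular ⇒ the Hodge-constrained deformation functor of `E₀` is unobstructed); the passage to
  EVERY `s ∈ B(ℂ)` uses that the algebraicity locus of a flat section is a countable union of
  Zariski-closed subsets (relative Hilbert/Chow schemes are proper components) and `B` is
  irreducible (`Smooth B.hom`, `ConnectedSpace B(ℂ)`) — consistent with the stub's hypotheses.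
  `{0,1}`-semiregular ((σ₀,σ₁) injective) ⇒ semiregular (σ has more components). Degenerate family
  `B = Spec ℂ`: the stub reduces to `ch_mem_algebraicClasses` ✓. No misstatement found; rendering
  risk sits in `FiberClass`/`locusOfHodgeClasses` (if continuity in the étalé topology were junk,
  the stub would still follow from HC, not contradict it).
* `stub_AnchoredTwinHeckeFamilies` on paper: flat sections exist globally iff monodromy-invariant:
  on the polarised twin Hecke family the invariants are exactly `⟨u⊗1, 1⊗Nu⟩`, `⟨graph M, u⊗Nu,
  pt⊗1, 1⊗pt⟩`, `⟨u⊗pt, pt⊗Nu⟩` ((γ, MγN) preserves `graph M`) ✓; the component clause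
  `‖(x₀.x)‖ < ‖(x₀.x̄)‖` IS "same connected component of the period domain in `u^⊥`
  (signature (2,19))": with `x₀ = f₁ + i f₂`, `x = e₁ + i e₂`, `A = (f₁.e₁)`, `B = (f₁.e₂)`,
  `C = (f₂.e₁)`, `D = (f₂.e₂)` one has `|(x₀.x)|² − |(x₀.x̄)|² = −4(AD − BC)`
  (`componentTest_identity`), and the orthogonal projection between positive 2-planes in signature
  `(2,19)` is an isomorphism, orientation-preserving iff `AD − BC > 0` ✓. Universal families over
  level covers of `F_{2d}` (Baily–Borel; level ≥ 3) supply `IsSmoothProjectiveFamily`; the twin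
  `S″` is polarised by a multiple of `Nu` (`(Nu)² = u²/q > 0`) ✓. No misstatement found.
* `stub_SemiregularTwinCarriers` (THE BET) on paper — necessary arithmetic of a clean carrier
  `E₀` on `S₀ × S₀″` at the honest orientation: (i) integrality of `c₂(E₀)` and torsion-free
  Künneth make the `H²⊗H²`-component of `ch₂(E₀)` an INTEGRAL map `Λ″ → Λ` equal to
  `m·ψ + (rank ≤ 1)`, so `m` is pinned to `(1/index)·ℤ` once `M` is chosen — no obstruction;
  (ii) if the slices `E_t = E₀|_{S₀×{t}}` are stable with Mukai vector `v`, the classifying map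
  `S₀″ ⇢ M_{S₀}(v)` composed with Mukai's Hodge isometry is a `deg`-similitude, forcing a dominant
  rational map of degree `m²q` between K3 surfaces (Shafarevich's problem; for `q = 2`, `m = 1` a
  degree-2 map = a Nikulin involution, so `ρ(S₀″) ≥ 9`) — NOT an obstruction to the stub, because
  the stub lets the carrier-builder CHOOSE the anchor in each polarisation type and component
  (special anchors: Kummer / Nikulin / `ρ = 20`), exactly the route's original Nikulin-anchor idea;
  (iii) budget `ext²(E₀,E₀) ≤ h^{0,2} + h^{1,3} = 2 + 40 = 42` versus Fourier–Mukai-type kernels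
  `ext² = dim HH²`-like counts `24q − 2 ≥ 46` for `q ≥ 2` (card) — the open step. No contradiction
  derived; the stub is an existence claim that only a construction or a new obstruction
  (e.g. a Bogomolov-type inequality for semiregular bundles with `c₂ ∋ m·graph`) can settle.
* `stub_CorrespondenceComposition = CompCorr`: reduced in-tree to `KunnethSpan + CupAlg`
  (`compCorr_of_kunneth`, `corrComp_surfaces_of_kunneth'`); a theorem (Fulton 16.1.1). Not a target.
-/

/-- Any `∀ C : ChernCharacterBetti, …` statement — the literal shape of
`SemiregularVariationalHodge` (skeleton l.279) and `AnchoredTwinHeckeFamilies` (l.352) — holds if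
no Chern character on the real carriers exists in the tree's sense. [folklore] -/
theorem forallChern_of_isEmpty (h : IsEmpty ChernCharacterBetti) (P : ChernCharacterBetti → Prop) :
    ∀ C : ChernCharacterBetti, P C :=
  fun C => (h.false C).elim

/-- The literal shape of `SemiregularTwinCarriers` (skeleton l.315:
`∀ q prime, ∃ M N, RatSimil[q, M, N] ∧ ∀ C : ChernCharacterBetti, …`) holds if
`ChernCharacterBetti` is empty: the outer existential is the landed `exists_ratSimilitude_k3Lattice`.
So THE BET is irrefutable until stub 1 (`Nonempty ChernCharacterBetti`) is constructed. [folklore] -/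
theorem carriersShape_of_isEmpty (h : IsEmpty ChernCharacterBetti)
    (P : ℕ → Module.End ℂ (K3Index → ℂ) → Module.End ℂ (K3Index → ℂ) → ChernCharacterBetti → Prop) :
    ∀ q : ℕ, q.Prime →
      ∃ (M N : Module.End ℂ (K3Index → ℂ)),
        ((∀ v : K3Index → ℤ, ∃ w : K3Index → ℚ, M (fun i => (v i : ℂ)) = fun i => (w i : ℂ)) ∧
          (∀ v : K3Index → ℤ, ∃ w : K3Index → ℚ, N (fun i => (v i : ℂ)) = fun i => (w i : ℂ)) ∧
          M * N = 1 ∧ N * M = 1 ∧ ∀ a b, k3Form (M a) (M b) = ((q : ℕ) : ℂ) * k3Form a b) ∧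
        ∀ C : ChernCharacterBetti, P q M N C := by
  intro q hq
  obtain ⟨M, N, hM, hN, hMN, hNM, hform⟩ := exists_ratSimilitude_k3Lattice q hq.pos
  exact ⟨M, N, ⟨hM, hN, hMN, hNM, hform⟩, fun C => (h.false C).elim⟩

/-- **The component test of `TwinAnchor` is correct** (sign convention certified): for real
pairings `A = (f₁.e₁)`, `B = (f₁.e₂)`, `C = (f₂.e₁)`, `D = (f₂.e₂)` of the real and imaginary
parts of two periods `x₀ = f₁ + i f₂`, `x = e₁ + i e₂`, the bilinear pairings are
`(x₀.x) = (A − D) + i(B + C)` and `(x₀.x̄) = (A + D) + i(C − B)`, and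
`|(x₀.x)|² − |(x₀.x̄)|² = −4 (AD − BC)`: the stub's `‖(x₀.x)‖ < ‖(x₀.x̄)‖` is `det G > 0` for the
Gram matrix `G` between the two positive 2-planes, i.e. "same component". [folklore] -/
theorem componentTest_identity (A B C D : ℝ) :
    Complex.normSq ⟨A - D, B + C⟩ - Complex.normSq ⟨A + D, C - B⟩ = -4 * (A * D - B * C) := by
  simp only [Complex.normSq_apply]
  ring

/-- Cup powers are homogeneous: `(a • x)ⁱ = aⁱ • xⁱ`. [folklore] -/
theorem cupPowTwo_smul {Y : Type} [TopologicalSpace Y] (a : ℂ) (x : singularCohomology ℂ ℂ Y 2)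
    (i : ℕ) : cupPowTwo (a • x) i = a ^ i • cupPowTwo x i := by
  induction i with
  | zero => simp
  | succ i ih =>
    rw [cupPowTwo_succ, cupPowTwo_succ, ih, map_smul, map_smul, LinearMap.smul_apply, smul_smul]
    congr 1
    ring

/-- **The junk catalogue of `ChernCharacterBetti`, certified: rescaling by `λⁱ` in degree `2i`
(`λ ∈ ℚˣ`) maps instances to instances.** So every `∀ C : ChernCharacterBetti`-stub of the line
(2, 3, 4) that holds for `C` must hold for `chernRescale C λ`: statements about `C.ch` are only
meaningful up to `chᵢ ↦ λⁱ chᵢ` (the planner's `CleanChern[…]` is invariant: `m ↦ λ²m`, `a ↦ λ²a`,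
…; in particular the fields never pin `m` to the topological value, nor `ch₁(𝒪(D)) = cl(D)`).
This is the ONLY junk transform found (functoriality along all `ℂ`-morphisms is strong); it yields
no kill. [folklore] -/
def chernRescale (C : ChernCharacterBetti) (l : ℚ) (hl : l ≠ 0) : ChernCharacterBetti where
  ch X E i := ((l : ℂ) ^ i) • C.ch X E i
  ch_congr e i := by rw [C.ch_congr e i]
  ch_shortExact S hS h₁ h₃ i := by rw [C.ch_shortExact S hS h₁ h₃ i, smul_add]
  map_ch f E hE i := by rw [map_smul, C.map_ch f E hE i]
  ch_free_zero X I := by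
    intro _
    rw [pow_zero, one_smul, C.ch_free_zero X I]
  ch_free_of_pos X I := by
    intro _ i hi
    rw [C.ch_free_of_pos X I hi, smul_zero]
  ch_of_hasRankLE_one hL i hi := by
    rw [C.ch_of_hasRankLE_one hL hi, pow_one, cupPowTwo_smul, smul_comm]
  isRationalClass_ch X E hE i := by
    have h := (C.isRationalClass_ch X E hE i).smul (l ^ i)
    rwa [Rat.cast_pow] at h
  ch_mem_algebraicClasses hX E hE i := Submodule.smul_mem _ _ (C.ch_mem_algebraicClasses hX E hE i)
  algebraicClasses_le_span_ch := fun {n} {X} hX p => by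
    refine (C.algebraicClasses_le_span_ch hX p).trans ?_
    have hu : IsUnit ((l : ℂ) ^ p) := isUnit_iff_ne_zero.2 (pow_ne_zero p (by exact_mod_cast hl))
    have hset : {c : complexBetti X (2 * p) | ∃ E : X.left.Modules, IsVectorBundle E ∧
          ((l : ℂ) ^ p) • C.ch X E p = c} =
        ((l : ℂ) ^ p) • {c : complexBetti X (2 * p) | ∃ E : X.left.Modules, IsVectorBundle E ∧
          C.ch X E p = c} := by
      ext c
      constructor
      · rintro ⟨E, hE, rfl⟩
        exact Set.smul_mem_smul_set ⟨E, hE, rfl⟩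
      · rintro ⟨d, ⟨E, hE, rfl⟩, rfl⟩
        exact ⟨E, hE, rfl⟩
    rw [hset, Submodule.span_smul_eq_of_isUnit _ _ hu]

/-- The rescaled Chern character in degree `2i` is `λⁱ` times the original. [folklore] -/
theorem chernRescale_ch (C : ChernCharacterBetti) (l : ℚ) (hl : l ≠ 0) (X : SchemeOver ℂ)
    (E : X.left.Modules) (i : ℕ) : (chernRescale C l hl).ch X E i = ((l : ℂ) ^ i) • C.ch X E i := rfl

/-! ## §4 Load-bearing hypotheses, strengthenings, why it resists, next regimes

LOAD-BEARING TABLE (crux `HodgeSimilitudeAlgebraic`; "drop H ⇒ ?"):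
* `0 < r` — DECORATION: `crux ↔ ∀ r ≠ 0, SimAlgAt[r]` (`crux_iff_forall_ne_zero`, no fact);
  `r = 0` (isotropic image) reduces on paper to Lefschetz (1,1) (`ψ` kills `T(S′)`, lands in `NS`).
* signs of the generators `p, p′` — VACUOUS branches: `no_antisimilitude_of_markings` (§2), given
  markings (`Huybrechts_K3_marking_exists`) and `eq_or_eq_neg_of_zsmul`.
* `μ : OrientationFamily` — GAUGE: two families give proportional Gysin maps
  (`complexGysin_eq_smul_of_orientationFamily`), absorbed by `γ ↦ c·γ` (`algebraicClasses` is a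
  `ℂ`-subspace). A `ℂ`-orientation of the connected `X(ℂ)` is `c·[X]`, `c ∈ ℂˣ` (local
  consistency of `HomologicalOrientation`), nothing more.
* `hrat` (ψ rational) — LOAD-BEARING only GENERICALLY (paper, refined in cycle 2): for `S` with
  `End_Hdg(T_ℚ) = ℚ` the rotation `e^{iθ} ⊕ 1 ⊕ e^{−iθ}` on `H^{2,0} ⊕ T^{1,1} ⊕ H^{0,2}` (⊕ `1`
  on `NS`) is a type-preserving isometry outside `ℂ·{algebraic classes}|_T ⊆ End_Hdg(T) ⊗ ℂ = ℂ`;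
  but at CM points (ρ = 20, e.g. the explicit period `x₀` of §2b, CM by `ℚ(i)`) the conclusion only
  asks for a COMPLEX combination of algebraic classes and `End_Hdg(T) ⊗ ℂ = ℂ²` contains the
  rotation — there `hrat` is NOT load-bearing (HC for CM squares is the tree fact
  `Buskin2019_hodgeConjectureFor_square_of_CM`). A Lean version needs a very general period.
* `htype` (type-preserving) — LOAD-BEARING, CERTIFIED on the real carriers modulo named facts
  (§2b `hodgeSimilitudeAlgebraic_false_without_htype`).
* `hsim` (similitude) — NOT load-bearing FOR TRUTH: dropping it gives "every rational
  type-preserving `ψ` is algebraic" = HC for all Hodge classes in `H²(S)⊗H²(S′)`, still a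
  consequence of HC. It is load-bearing for the MECHANISM only (Buskin/twistor transport, twins).
* K3 hypotheses (`H¹(𝒪) = 0`, nowhere-vanishing holomorphic 2-form on a Hodge model) — weakening
  them only enlarges the class of surfaces (abelian surfaces…), and the statement stays a
  consequence of HC (`hS.1 = IsSmoothProjective 2 S` is Mathlib-real); no kill from K3-junk.
* RENDERING (interfaces): `HodgeModel`/`IsOfHodgeType` (∃ over models; models unique up to
  biholomorphism by `IsAnalytification` — regular functions holomorphic in the atlas excludes the
  conjugate structure —, natural `ℂ`-linear de Rham families differ by scalars), `IsRationalClass`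
  (ℚ-valued cocycles; `isRationalClass_iff_of_marking`), `algebraicClasses = N^p` (coniveau),
  `complexGysin` (PD-based): all real; junk carriers satisfy the CONCLUSION (`γ = 0`), never
  falsify it. Verdict unchanged from gen-1/gen-2: no junk model.

STRENGTHENINGS (status):
* integral version (integral similitudes induced by INTEGRAL cycles) — false in general
  (Atiyah–Hirzebruch-type/`Barriers/…/AtiyahHirzebruch1962_torsionClass_notAlgebraic` concerns
  torsion; for K3×K3 the relevant failure is the non-surjectivity of integral Hodge classes onto
  integral algebraic ones — not engaged by the ℚ-statement).
* EFFECTIVE cycle inducing `ψ` — false at `p = 2` off the Nikulin locus (gen-2 v3: a prime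
  effective correspondence of degree 1 over `S` would be the graph of a degree-2 rational map,
  forcing a Nikulin involution); open for odd `p` and degrees `2m² > 2`.
* `∀ μ` without PD (`μ.HasPoincareDuality` dropped) — harmless: `complexGysin` is DEFINED for every
  `μ`; PD is used only in the Gysin calculus of proofs, and `hasPoincareDuality_of` derives it from
  the named fact `bijective_poincareDualityMap` for every family.
* "no anchor pair at some prime" — REFUTED on paper (gen-2 v3): Kummer anchors `Km A ⇢ Km(A/H)` at
  every odd `p` (BSV arXiv:1510.07465 §6.5), integral completion with algebraic graph.
* lattice obstruction "no integral p-twin for p > 7" — REFUTED (gen-2 §3: `E₈(p) ⊂ E₈`,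
  `p ≤ 13`, by decide; rationally for all `n` by the landed `exists_ratSimilitude_k3Lattice`; this
  file adds the explicit `A₁⁸ ⊂ E₈` frame `e8Roots`).

KNOWN REGION (gen-2 v4, paper): `SimAlgAt[n]` holds for every `n` on twin pairs with
`T(S)_ℚ ↪ U³_ℚ` (ρ ≥ 19, Kummer, Shioda–Inose) via Ma arXiv:0905.4107 Thm 1.2 + `End_Hdg(T) = ℚ`
or CM; on the Nikulin/σ₃ loci for √2, √3 (Varesco2023 Thm 2.1/2.9); everywhere under KS-HC
(Varesco2023 Thm 0.3); CM pairs (Buskin2019_hodgeConjectureFor_square_of_CM).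

WHY IT RESISTS. (1) Truth side: crux ⟸ HC(S × S′); no counterexample to HC is known, and every
degenerate/limit regime of the statement (signs, `r ≤ 0`, gauge, junk carriers) is either vacuous
or trivially satisfied, certified above. (2) Falsity side in Lean: `¬crux` needs an actual
projective K3 pair in Mathlib's `Scheme` with a computed `N² H⁴(S × S′)` — beyond the tree; and no
interface admits a junk inhabitant that falsifies the conclusion. (3) The line's stubs: the only
refutable content is `stub 1 ∧ stub 3`; stubs 2, 4, 5 are theorems on paper.

NEXT REGIMES (for cycle 3 / drefute once a line is PICKED): (a) attack `SemiregularTwinCarriers`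
through a NECESSARY CONDITION provable without constructing `C`: e.g. show that clean Chern data +
`{0,1}`-semiregularity force `rank E₀ ≥ ?` or a Bogomolov-type inequality on each K3 slice
(`Δ(E_t) = 2rc₂ − (r−1)c₁² ≥ 0` for slope-semistable slices) incompatible with `m ≠ 0` at small
rank — a `SemiregularTwinCarriers_false_of_<H>` negative lemma modulo a precise stability
hypothesis H; (b) the `q = 2`, `m = 1` slice argument above as a Lean lemma at lattice level
(degree-2 similitude Λ″ → Λ from an integral `(2,2)`-class forces a Nikulin-type sublattice
`E₈(−2) ⊂ NS`); (c) keep `componentTest`/monodromy checks ready for the lead's reshaped stubs.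
-/

end Summit.HodgeConjecture.HodgeConjecture.Cruxes.HodgeSimilitudeAlgebraic.Disproof

end
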